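import Summits.CriticalPhenomena.SAWScalingLimit.Theorems.SAWDevelopingMapObservableToSLECanonicalTransferFill
import Summits.CriticalPhenomena.SAWScalingLimit.Theorems.SAWDevelopingMapObservableToSLECanonicalTransferLatticeChains
import Summits.CriticalPhenomena.SAWScalingLimit.Theorems.SAWDevelopingMapObservableToSLERestrictionCocycleHelpersLattice
import Summits.CriticalPhenomena.SAWScalingLimit.Theorems.SAWDefectDecoherenceDefectDecoherenceTmAdmissible
import HarnessLib

/-!
# Crux `SAWDevelopingMap.ObservableToSLE` (stmt-CriticalPhenomena-10472), line `six-class-type-ladder`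
(slug `Sketch`), stub T2a `stub_twoPieceAdmIdentification`: the FILLED sub-domain of an admissible
lattice domain and the restriction ratio as a probability

Landing target:
`Summits/CriticalPhenomena/SAWScalingLimit/Theorems/SAWDevelopingMapObservableToSLETypeLadderTwoPieceAdmIdentificationFill.lean`
(`--supports stmt-CriticalPhenomena-10472`).

Stub T2a applies the two-piece admissible restriction limit (`Z_{Λ'}/Z_Λ → Φ'_A(0)^{5/8}`) to
SUB-FAMILIES `Λ' δ ⊆ Λ δ` of a GIVEN admissible family `Λ δ`, carved out of `Λ δ` inside a hull
subdomain.  A carved set `G ⊆ Λ` (a lattice component) need not have a connected complement; this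
file supplies the purely graph-theoretic repair and the dictionary to probabilities:

* `exists_fill_subset` — **the fill of a connected `G ⊆ Λ` inside a simply connected `Λ`**: the
  vertices that cannot reach `Λᶜ` without crossing `G` form a finite `Λ'` with
  `G ⊆ Λ' ⊆ Λ`, simply connected (`hexDomainSimplyConnected`) and connected (crux 10472's
  `FloorRatio.exists_fill` with far set `Λᶜ`, connected because `Λ` is simply connected);
* `mem_fill_of_pathIn_compl` — the fill is closed under `Gᶜ`-chains: a `Gᶜ`-chain from a vertex of
  `Λ'` stays in `Λ'` (so a HOLE vertex is recognised by exhibiting NO escape, and a vertex with an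
  escape route to `Λᶜ` avoiding `G` is not in the fill);
* `mem_hexDomainBoundary_of_subset` — boundary mid-edges of `Λ` whose inner endpoint survives are
  boundary mid-edges of `Λ'`;
* `sum_eq_sum_ite_of_subset`, `ratio_eq_of_subset` — **the restriction ratio is a probability**:
  for `Λ' ⊆ Λ` and a starting mid-edge of `Ω(Λ')`,
  `Z_{Λ'}(a, b) = Σ_{γ ⊂ Λ : a → b, γ ⊆ Λ'} x_c^{ℓ(γ)}`, so `Z_{Λ'}/Z_Λ = P_Λ(γ ⊆ Λ')` for the
  Duminil-Copin–Smirnov law;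
* `sum_ite_le_sum_ite_of_imp` — monotonicity of the event sums.
-/

noncomputable section

open scoped BigOperators Classical
open Set
open Literature.Probability.LatticeModels (HexVertex hexGraph hexCenter)
open Literature.Probability.RandomPlanarGeometry
open Literature.Probability.RandomPlanarGeometry.SAW
open Literature.Probability.Percolation (PathIn)

namespace Summit.CriticalPhenomena.SAWScalingLimit.Theorems.ObservableToSLE.TypeLadder

open Summit.CriticalPhenomena.SAWScalingLimit.Theorems.ObservableToSLE.FloorRatio
  (exists_fill hexGraph_connected pathIn_of_walk exists_injective_of_forall_verts)
open Summit.CriticalPhenomena.SAWScalingLimit.Theorems.DefectDecoherence.TipMartingale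
  (pathIn_of_preconnected)

/-! ### `PathIn` chains -/

/-- Any two honeycomb vertices are joined by a `PathIn` chain of the whole lattice. [folklore] -/
theorem pathIn_univ (x y : HexVertex) : PathIn hexGraph univ x y := by
  obtain ⟨W⟩ := hexGraph_connected.preconnected x y
  exact pathIn_of_walk W fun _ _ => mem_univ _

/-! ### The fill of a connected subset of a simply connected domain -/

/-- **The fill of a connected `G ⊆ Λ` inside a simply connected `Λ`.**  Let `Λ` be a simply
connected hexagonal-lattice domain (connected complement) and `G ⊆ Λ` a set of vertices joined
pairwise by chains inside `G`.  Then the vertices from which `Λᶜ` cannot be reached by a chain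
avoiding `G` form a finite domain `Λ'` with `G ⊆ Λ' ⊆ Λ`, simply connected and connected.
(`FloorRatio.exists_fill` with far set `Λᶜ`: it has finite complement, its vertices are pairwise
joined inside `Λᶜ ⊆ Gᶜ`, and every vertex reaches it, `Λ` being finite.) [folklore] -/
theorem exists_fill_subset {Λ : Finset HexVertex} (hΛ : hexDomainSimplyConnected Λ)
    {G : Set HexVertex} (hGΛ : G ⊆ ↑Λ) (hG : ∀ x ∈ G, ∀ y ∈ G, PathIn hexGraph G x y) :
    ∃ Λ' : Finset HexVertex, G ⊆ ↑Λ' ∧ Λ' ⊆ Λ ∧ hexDomainSimplyConnected Λ' ∧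
      (hexGraph.induce (↑Λ' : Set HexVertex)).Preconnected ∧
      ∀ z : HexVertex, z ∈ Λ' ↔ ¬ ∃ w ∉ Λ, PathIn hexGraph Gᶜ z w := by
  set F : Set HexVertex := (↑Λ : Set HexVertex)ᶜ with hF
  have hfin : Fᶜ.Finite := by rw [hF, compl_compl]; exact Λ.finite_toSet
  have hFG : F ⊆ Gᶜ := compl_subset_compl.2 hGΛ
  have hFF : ∀ w₁ ∈ F, ∀ w₂ ∈ F, PathIn hexGraph Gᶜ w₁ w₂ := fun w₁ hw₁ w₂ hw₂ =>
    (pathIn_of_preconnected hΛ hw₁ hw₂).mono hFG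
  have hreach : ∀ z : HexVertex, ∃ w ∈ F, PathIn hexGraph univ z w := fun z => by
    obtain ⟨w, hw⟩ := Infinite.exists_notMem_finset Λ
    exact ⟨w, hw, pathIn_univ z w⟩
  obtain ⟨Λ', hGΛ', hsc, hconn, hmem⟩ := exists_fill hG hfin hFF hreach
  refine ⟨Λ', hGΛ', fun z hz => ?_, hsc, hconn, fun z => ?_⟩
  · by_contra hzΛ
    exact (hmem z).1 hz ⟨z, hzΛ, PathIn.refl (hFG hzΛ)⟩
  · rw [hmem z]
    rfl

/-- **The fill is closed under `Gᶜ`-chains**: if `Λ'` is the fill of `G` inside `Λ` and a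
`Gᶜ`-chain starts at a vertex of `Λ'`, it ends in `Λ'` (an escape of the endpoint would be an
escape of the start). [folklore] -/
theorem mem_fill_of_pathIn_compl {Λ Λ' : Finset HexVertex} {G : Set HexVertex}
    (hmem : ∀ z : HexVertex, z ∈ Λ' ↔ ¬ ∃ w ∉ Λ, PathIn hexGraph Gᶜ z w)
    {z w : HexVertex} (hz : z ∈ Λ') (hp : PathIn hexGraph Gᶜ z w) : w ∈ Λ' := by
  rw [hmem] at hz ⊢
  rintro ⟨w', hw', hww'⟩
  exact hz ⟨w', hw', hp.trans hww'⟩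

/-- **Escape criterion**: a vertex joined to a vertex outside `Λ` by a chain avoiding `G` is not
in the fill. [folklore] -/
theorem not_mem_fill_of_pathIn_compl {Λ Λ' : Finset HexVertex} {G : Set HexVertex}
    (hmem : ∀ z : HexVertex, z ∈ Λ' ↔ ¬ ∃ w ∉ Λ, PathIn hexGraph Gᶜ z w)
    {z w : HexVertex} (hw : w ∉ Λ) (hp : PathIn hexGraph Gᶜ z w) : z ∉ Λ' := fun hz =>
  ((hmem z).1 hz) ⟨w, hw, hp⟩

/-- **Holes are joined to `G` only through... nothing: a vertex of the fill outside `G` all of whose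
`Gᶜ`-chains stay inside `Λ`** — contrapositive packaging of the escape criterion used by the
continuum escape lemma: if `z ∈ Λ' ∖ G` then every `Gᶜ`-chain from `z` ends inside `Λ`.
[folklore] -/
theorem forall_pathIn_compl_mem {Λ Λ' : Finset HexVertex} {G : Set HexVertex}
    (hmem : ∀ z : HexVertex, z ∈ Λ' ↔ ¬ ∃ w ∉ Λ, PathIn hexGraph Gᶜ z w)
    {z : HexVertex} (hz : z ∈ Λ') : ∀ w : HexVertex, PathIn hexGraph Gᶜ z w → w ∈ Λ := by
  intro w hp
  by_contra hw
  exact not_mem_fill_of_pathIn_compl hmem hw hp hz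

/-! ### Boundary mid-edges of sub-domains -/

/-- **Boundary mid-edges survive in sub-domains keeping their inner endpoint**: if `e = {u, v}` is
a boundary mid-edge of `Λ` (`v ∈ Λ ∌ u`) and `Λ' ⊆ Λ` contains every endpoint of `e` lying in `Λ`,
then `e` is a boundary mid-edge of `Λ'`. [cite: DuminilCopinSmirnov2012, §2 (domains)] -/
theorem mem_hexDomainBoundary_of_subset {Λ Λ' : Finset HexVertex} (h : Λ' ⊆ Λ)
    {e : Sym2 HexVertex} (he : e ∈ hexDomainBoundary Λ) (hin : ∀ v ∈ e, v ∈ Λ → v ∈ Λ') :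
    e ∈ hexDomainBoundary Λ' := by
  obtain ⟨hedge, u, v, rfl, hv, hu⟩ := he
  exact ⟨hedge, u, v, rfl, hin v (Sym2.mem_mk_right u v) hv, fun hu' => hu (h hu')⟩

/-- The inner endpoint of a boundary mid-edge: for `e ∈ ∂Ω(Λ)` there are `u ∉ Λ`, `v ∈ Λ` with
`e = {u, v}` and `u ∼ v`. [cite: DuminilCopinSmirnov2012, §2 (domains)] -/
theorem exists_of_mem_hexDomainBoundary {Λ : Finset HexVertex} {e : Sym2 HexVertex}
    (he : e ∈ hexDomainBoundary Λ) :
    ∃ u v : HexVertex, e = s(u, v) ∧ hexGraph.Adj u v ∧ u ∉ Λ ∧ v ∈ Λ := by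
  obtain ⟨hedge, u, v, rfl, hv, hu⟩ := he
  exact ⟨u, v, rfl, (SimpleGraph.mem_edgeSet _).1 hedge, hu, hv⟩

/-- A boundary mid-edge of `Λ'` is a mid-edge of `Ω(Λ')`. [cite: DuminilCopinSmirnov2012, §2 (domains)] -/
theorem mem_hexDomainMidEdges_of_mem_boundary {Λ : Finset HexVertex} {e : Sym2 HexVertex}
    (he : e ∈ hexDomainBoundary Λ) : e ∈ hexDomainMidEdges Λ :=
  hexDomainBoundary_subset Λ he

/-! ### The restriction ratio as a probability -/

/-- **`Z_{Λ'}(a, b)` as a restricted sum over the walks of `Λ`.**  For `Λ' ⊆ Λ` and a mid-edge `a`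
of `Ω(Λ')`, the walks `a → b` of `Λ'` are exactly the walks `a → b` of `Λ` all of whose vertices
lie in `Λ'` (same vertex lists), so that for every weight `f` of the length,
`Σ_{γ ⊂ Λ'} f(ℓ(γ)) = Σ_{γ ⊂ Λ, γ ⊆ Λ'} f(ℓ(γ))`. [cite: LawlerSchrammWerner2004SAW, §3.4 ("SAW satisfies restriction")] -/
theorem sum_eq_sum_ite_of_subset {Λ Λ' : Finset HexVertex} (h : Λ' ⊆ Λ) {a b : Sym2 HexVertex}
    (ha : a ∈ hexDomainMidEdges Λ') (f : ℕ → ℝ) :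
    ∑ γ : HexMidEdgeSAW Λ' a b, f γ.length =
      ∑ γ : HexMidEdgeSAW Λ a b, if (∀ v ∈ γ.verts, v ∈ Λ') then f γ.length else 0 := by
  obtain ⟨ι, hι, hιv⟩ := exists_injective_of_forall_verts (Λ := Λ) (s := a) (t := b) ha
    (fun v => v ∈ Λ') (fun _ _ hv => hv)
  -- `ι` is also surjective: lift a walk of `Λ'` to `Λ`
  have hsurj : Function.Surjective ι := fun γ' => by
    refine ⟨⟨⟨γ'.verts, fun v hv => h (γ'.subset v hv), γ'.nodup, γ'.isChain, γ'.head_mem,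
      γ'.getLast_mem, γ'.eq_of_nil, γ'.edges_nodup,
      ⟨γ'.fst_mem.1, γ'.fst_mem.2.imp fun v hv => ⟨hv.1, h hv.2⟩⟩⟩, γ'.subset⟩, ?_⟩
    exact HexMidEdgeSAW.ext (hιv _)
  rw [← Finset.sum_filter, ← Finset.sum_subtype_eq_sum_filter]
  symm
  calc ∑ γ ∈ (Finset.univ : Finset (HexMidEdgeSAW Λ a b)).subtype
          (fun γ => ∀ v ∈ γ.verts, v ∈ Λ'), f (γ : HexMidEdgeSAW Λ a b).length
      = ∑ γ : {γ : HexMidEdgeSAW Λ a b // ∀ v ∈ γ.verts, v ∈ Λ'}, f γ.1.length := by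
        refine Finset.sum_congr ?_ fun _ _ => rfl
        ext γ
        simp
    _ = ∑ γ' : HexMidEdgeSAW Λ' a b, f γ'.length := by
        refine Fintype.sum_bijective ι ⟨hι, hsurj⟩ _ _ fun γ => ?_
        rw [HexMidEdgeSAW.length, HexMidEdgeSAW.length, hιv]

/-- **The restriction ratio is a probability**: for `Λ' ⊆ Λ` and a mid-edge `a` of `Ω(Λ')`,
`Z_{Λ'}(a,b)/Z_Λ(a,b) = (Σ_{γ ⊂ Λ : a → b, γ ⊆ Λ'} x_c^{ℓ(γ)}) / Z_Λ(a,b)`, the probability under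
the Duminil-Copin–Smirnov law of `Λ` that the walk stays in `Λ'`. [cite: LawlerSchrammWerner2004SAW, §3.4 ("SAW satisfies restriction")] -/
theorem ratio_eq_of_subset {Λ Λ' : Finset HexVertex} (h : Λ' ⊆ Λ) {a b : Sym2 HexVertex}
    (ha : a ∈ hexDomainMidEdges Λ') :
    (∑ γ : HexMidEdgeSAW Λ' a b, hexCriticalFugacity ^ γ.length) /
        (∑ γ : HexMidEdgeSAW Λ a b, hexCriticalFugacity ^ γ.length) =
      (∑ γ : HexMidEdgeSAW Λ a b,
          if (∀ v ∈ γ.verts, v ∈ Λ') then hexCriticalFugacity ^ γ.length else 0) /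
        (∑ γ : HexMidEdgeSAW Λ a b, hexCriticalFugacity ^ γ.length) := by
  rw [sum_eq_sum_ite_of_subset h ha (fun n => hexCriticalFugacity ^ n)]

/-- **Monotonicity of event sums**: if event `P` implies event `Q` on the walks, the `x_c`-mass of
`P` is at most that of `Q`. [folklore] -/
theorem sum_ite_le_sum_ite_of_imp {Λ : Finset HexVertex} {a b : Sym2 HexVertex}
    {P Q : HexMidEdgeSAW Λ a b → Prop} (hPQ : ∀ γ, P γ → Q γ) :
    (∑ γ : HexMidEdgeSAW Λ a b, if P γ then hexCriticalFugacity ^ γ.length else 0) ≤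
      ∑ γ : HexMidEdgeSAW Λ a b, if Q γ then hexCriticalFugacity ^ γ.length else 0 := by
  refine Finset.sum_le_sum fun γ _ => ?_
  by_cases hP : P γ
  · rw [if_pos hP, if_pos (hPQ γ hP)]
  · rw [if_neg hP]
    split_ifs
    · exact pow_nonneg hexCriticalFugacity_pos_lt_one.1.le _
    · exact le_rfl

/-- Event sums divided by the partition function are monotone in the event. [folklore] -/
theorem div_le_div_of_imp {Λ : Finset HexVertex} {a b : Sym2 HexVertex}
    {P Q : HexMidEdgeSAW Λ a b → Prop} (hPQ : ∀ γ, P γ → Q γ) :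
    (∑ γ : HexMidEdgeSAW Λ a b, if P γ then hexCriticalFugacity ^ γ.length else 0) /
        (∑ γ : HexMidEdgeSAW Λ a b, hexCriticalFugacity ^ γ.length) ≤
      (∑ γ : HexMidEdgeSAW Λ a b, if Q γ then hexCriticalFugacity ^ γ.length else 0) /
        (∑ γ : HexMidEdgeSAW Λ a b, hexCriticalFugacity ^ γ.length) :=
  div_le_div_of_nonneg_right (sum_ite_le_sum_ite_of_imp hPQ)
    (Finset.sum_nonneg fun _ _ => pow_nonneg hexCriticalFugacity_pos_lt_one.1.le _)

/-! ### Registry form -/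

/-- **Registered sub-goal `stub_twoPieceAdmIdentification_fill`** (crux item
stmt-CriticalPhenomena-10472, line `six-class-type-ladder`, stub `stub_twoPieceAdmIdentification`):
registry form of `exists_fill_subset` — the fill of a connected `G ⊆ Λ` inside a simply connected
lattice domain `Λ` is a simply connected, connected domain `Λ'` with `G ⊆ Λ' ⊆ Λ`, characterised
as the vertices with no `Gᶜ`-chain to `Λᶜ`. [folklore] -/
theorem stub_twoPieceAdmIdentification_fill :
    ∀ (Λ : Finset HexVertex) (G : Set HexVertex), hexDomainSimplyConnected Λ → G ⊆ ↑Λ →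
      (∀ x ∈ G, ∀ y ∈ G, Literature.Probability.Percolation.PathIn hexGraph G x y) →
      ∃ Λ' : Finset HexVertex, G ⊆ ↑Λ' ∧ Λ' ⊆ Λ ∧ hexDomainSimplyConnected Λ' ∧
        (hexGraph.induce (↑Λ' : Set HexVertex)).Preconnected ∧
        ∀ z : HexVertex, z ∈ Λ' ↔
          ¬ ∃ w ∉ Λ, Literature.Probability.Percolation.PathIn hexGraph Gᶜ z w :=
  fun _ _ hΛ hGΛ hG => exists_fill_subset hΛ hGΛ hG

end Summit.CriticalPhenomena.SAWScalingLimit.Theorems.ObservableToSLE.TypeLadder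

end
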